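import Mathlib
import HarnessLib
import Summits.Ventures.LatticeQCDFlow.Exactness.NCMCGeneralSpacePathIMH

/-!
# What the switch's run-time estimators read, on a general state space: two-direction acceptance and Bennett's identity

HONEST FRAMING: exact (Metropolis-corrected) sampling algorithms for lattice gauge theory;
figures of merit are autocorrelation/cost numbers at stated couplings and volumes; no
continuum-physics claim.

Venture `LatticeQCDFlow` (cell pub-lqcd), topic `Exactness`; FANOUT row 13 (`eng-snf`, GEN-9).
NEW WORK of the cell (general measure theory, elementary), not a published result; nothing is
cited as a fact (Crooks 1998/2000; Nilmeier–Crooks–Minh–Chodera 2011; C. H. Bennett,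
J. Comput. Phys. 22 (1976) 245 named only).  General-state-space counterparts, for an arbitrary
Crooks pair of `NCMCGeneralSpace.lean` (Crooks' identity for expectations is
`CrooksPair.lintegral_mul_exp_neg_work` of `NCMCGeneralSpacePathIMH.lean`), of three finite-space
identities the engine's diagnostics rest on: row 8's `NCMCAcceptance.ncmcAccRate_eq_prob_add_prob` and
`ncmcRevAccRate_eq_ncmcAccRate`, and the population Bennett equation of row 13's
`BennettAcceptanceRatio.lean`.

## Content (`P = ν₀ ∘ κF` the un-normalised forward record law, `Q = ν₁ ∘ κR` the reverse one)

* **`CrooksPair.lintegral_accF_eq`** — the TWO-DIRECTION FORMULA for the mean forward acceptance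
  mass at constant `c`: `∫ min(1, e^{-(W−c)}) dP = P{W ≤ c} + e^{c} · Q{c < W}` — non-positive
  dissipation is accepted surely, the rest is paid for by the reverse law (normalised at
  `c = ΔF`: `acc = P_F(W ≤ ΔF) + P_R(W > ΔF)`);
* **`CrooksPair.lintegral_accF_eq_lintegral_accR`** — the forward and the `e^{c}`-weighted reverse
  acceptance masses agree for every `c` (`levelBalance` on the whole space): the engine's
  `acceptance_forward` and `acceptance_reverse` estimate the same number at `c = ΔF`;
* `CrooksPair.lintegral_fwdFlow_eq_tilt` — the general-space ENTRY-STATE TILT (finite version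
  `EntryStateTilt.lean`): the entrance flow into a target set `B` is `e^{c} ∫_B R_c(y, Ω) dν₁`, the
  target weight tilted by the reverse acceptance mass;
* **`CrooksPair.bennett_identity`** — BENNETT'S POPULATION IDENTITY with the Fermi function
  `σ(x) = 1/(1+e^{-x})` (Mathlib `Real.sigmoid`): `∫ σ(c − W) dP = e^{c} ∫ σ(W − c) dQ` for EVERY
  `c` — the balance of the Barker acceptance pair, whose SAMPLE version (forward works from `P_F`,
  reverse works from `P_R`) is the equation the engine's `estimators.bar` / `ncmc.c_from_works`
  solves for `c` (unique root: `BennettAcceptanceRatio.barFn_existsUnique_root`, finite sums).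
-/

namespace Summit.Ventures.LatticeQCDFlow.Exactness.GeneralNCMC

open MeasureTheory ProbabilityTheory Set
open scoped ENNReal

variable {Ω E : Type*} [MeasurableSpace Ω] [MeasurableSpace E]

namespace CrooksPair

variable {ν₀ ν₁ : Measure Ω} {κF κR : Kernel Ω E} {s e : E → Ω} {W : E → ℝ}

/-- **Two-direction formula for the mean forward acceptance.**  For every `c`,
`∫ min(1, e^{-(W − c)}) dP = P{W ≤ c} + e^{c} · Q{c < W}`: records with `W ≤ c` are accepted surely,
the others with probability `e^{c} e^{-W}`, whose `P`-integral is `e^{c}` times their `Q`-mass. -/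
theorem lintegral_accF_eq (h : CrooksPair ν₀ ν₁ κF κR s e W) (c : ℝ) :
    ∫⁻ ε, accF c W ε ∂(ν₀.bind κF) =
      (ν₀.bind κF) {ε | W ε ≤ c} + ENNReal.ofReal (Real.exp c) * (ν₁.bind κR) {ε | c < W ε} := by
  have hle : MeasurableSet {ε | W ε ≤ c} := h.measurable_W measurableSet_Iic
  have hgt : MeasurableSet {ε | c < W ε} := h.measurable_W measurableSet_Ioi
  -- split the acceptance along `W ≤ c`
  have hsplit : ∀ ε, accF c W ε =
      {ε | W ε ≤ c}.indicator 1 ε +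
        ENNReal.ofReal (Real.exp (-W ε)) *
          (ENNReal.ofReal (Real.exp c) * {ε | c < W ε}.indicator 1 ε) := fun ε => by
    by_cases hW : W ε ≤ c
    · have hn : ε ∉ {ε | c < W ε} := fun h' => absurd (h' : c < W ε) (not_lt.2 hW)
      rw [indicator_of_mem (show ε ∈ {ε | W ε ≤ c} from hW), indicator_of_notMem hn, mul_zero,
        mul_zero, add_zero, Pi.one_apply, accF, min_eq_left]
      · simp
      · rw [← Real.exp_zero]
        exact Real.exp_le_exp.2 (by linarith)
    · have hm : ε ∈ {ε | c < W ε} := (not_le.1 hW : c < W ε)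
      rw [indicator_of_notMem (show ε ∉ {ε | W ε ≤ c} from hW), indicator_of_mem hm, Pi.one_apply,
        mul_one, zero_add, accF, min_eq_right, ← ENNReal.ofReal_mul (Real.exp_pos _).le,
        ← Real.exp_add]
      · congr 1
        congr 1
        ring
      · rw [← Real.exp_zero]
        exact Real.exp_le_exp.2 (by linarith [not_le.1 hW])
  have hm2 : Measurable fun ε => ENNReal.ofReal (Real.exp c) * {ε | c < W ε}.indicator 1 ε :=
    measurable_const.mul (measurable_one.indicator hgt)
  simp_rw [hsplit]
  rw [lintegral_add_left (measurable_one.indicator hle), lintegral_indicator_one hle,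
    h.lintegral_mul_exp_neg_work hm2, lintegral_const_mul _ (measurable_one.indicator hgt),
    lintegral_indicator_one hgt]

/-- **Forward and reverse acceptance masses agree**, for every `c`:
`∫ min(1, e^{-(W−c)}) dP = e^{c} ∫ min(1, e^{W−c}) dQ` (`levelBalance` on the whole space; at
`c = ΔF`, after normalising, the two acceptance RATES are equal). -/
theorem lintegral_accF_eq_lintegral_accR (h : CrooksPair ν₀ ν₁ κF κR s e W) (c : ℝ) :
    ∫⁻ ε, accF c W ε ∂(ν₀.bind κF) =
      ENNReal.ofReal (Real.exp c) * ∫⁻ ε, accR c W ε ∂(ν₁.bind κR) := by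
  have hbal := h.levelBalance c MeasurableSet.univ MeasurableSet.univ
  rw [Measure.restrict_univ, Measure.restrict_univ] at hbal
  simp_rw [fwdFlow_univ, revFlow_univ] at hbal
  rw [Measure.lintegral_bind (Kernel.aemeasurable _) (measurable_accF c h.measurable_W).aemeasurable,
    Measure.lintegral_bind (Kernel.aemeasurable _) (measurable_accR c h.measurable_W).aemeasurable]
  exact hbal

/-- **Entry-state tilt on a general state space** (`EntryStateTilt.lean` is the finite version):
the stationary entrance flow into a target set `B` (prior level carrying `ν₀`, one Metropolized
forward switch) is `e^{c}` times the `ν₁`-integral over `B` of the REVERSE ACCEPTANCE MASS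
`R_c(y, Ω)` — the law of the state right after an accepted forward switch is the target weight
tilted by the probability that the reverse switch from it would be accepted. -/
theorem lintegral_fwdFlow_eq_tilt (h : CrooksPair ν₀ ν₁ κF κR s e W) (c : ℝ) {B : Set Ω}
    (hB : MeasurableSet B) :
    ∫⁻ x, fwdFlow κF c W e x B ∂ν₀ =
      ENNReal.ofReal (Real.exp c) * ∫⁻ y in B, revFlow κR c W s y univ ∂ν₁ := by
  have hbal := h.levelBalance c MeasurableSet.univ hB
  rwa [Measure.restrict_univ] at hbal

/-- **Bennett's population identity** (Barker / Fermi acceptance pair): for every `c`,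
`∫ σ(c − W) dP = e^{c} ∫ σ(W − c) dQ`, `σ = Real.sigmoid`.  Its sample version — forward works
against reverse works — is the equation whose unique root is the BAR estimate of `ΔF`. -/
theorem bennett_identity (h : CrooksPair ν₀ ν₁ κF κR s e W) (c : ℝ) :
    ∫⁻ ε, ENNReal.ofReal (Real.sigmoid (c - W ε)) ∂(ν₀.bind κF) =
      ENNReal.ofReal (Real.exp c) * ∫⁻ ε, ENNReal.ofReal (Real.sigmoid (W ε - c)) ∂(ν₁.bind κR) := by
  have hσ : Measurable fun ε => ENNReal.ofReal (Real.sigmoid (W ε - c)) :=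
    ((_root_.continuous_sigmoid).measurable.comp (h.measurable_W.sub measurable_const)).ennreal_ofReal
  have hg : Measurable fun ε =>
      ENNReal.ofReal (Real.exp c) * ENNReal.ofReal (Real.sigmoid (W ε - c)) :=
    measurable_const.mul hσ
  rw [← lintegral_const_mul _ hσ, ← h.lintegral_mul_exp_neg_work hg]
  refine lintegral_congr fun ε => ?_
  rw [← ENNReal.ofReal_mul (Real.exp_pos c).le, ← ENNReal.ofReal_mul (Real.exp_pos _).le]
  congr 1
  -- `e^{-W} (e^{c} σ(W − c)) = σ(W − c) e^{-(W − c)} = σ(c − W)`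
  have key := Real.sigmoid_mul_rexp_neg (W ε - c)
  rw [neg_sub] at key
  rw [← key, show -W ε = (c - W ε) + -c by ring, Real.exp_add]
  have : Real.exp (-c) * Real.exp c = 1 := by rw [← Real.exp_add, neg_add_cancel, Real.exp_zero]
  calc Real.sigmoid (W ε - c) * Real.exp (c - W ε)
      = Real.exp (c - W ε) * (Real.exp (-c) * Real.exp c) * Real.sigmoid (W ε - c) := by
        rw [this]; ring
    _ = Real.exp (c - W ε) * Real.exp (-c) * (Real.exp c * Real.sigmoid (W ε - c)) := by ring

end CrooksPair

end Summit.Ventures.LatticeQCDFlow.Exactness.GeneralNCMC
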